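import Literature.NumberTheory.DiophantineApproximation.PolylogHermitePadeRational
import Literature.NumberTheory.DiophantineApproximation.PolylogHermitePadeSeries
import HarnessLib

/-!
# The weight-`w` Hermite–Padé form at a rational point: `M^n S^{(w)}_n(M/N)`

Topic `Literature/NumberTheory/DiophantineApproximation`. For the weight-`w` type-I Hermite–Padé
form `S^{(w)}_n(x) = ∑_{u ≥ 0} R^{(w)}_n(u) x^{u+1}` of `PolylogHermitePade.lean`
(`PolylogPade.formW`) and a rational point `x = M/N` with `1 ≤ M`, `2M ≤ N`, a partial fraction
expansion of the kernel at the naturals,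
`R^{(w)}_n(u) = ∑_{p ≤ n} ∑_{o<w} c_{o,p}/(u+p+1)^{o+1}` (`BallRivoal.pfEval n w c u`; here it is
the HYPOTHESIS `hc`, discharged by `PolylogHermitePadeExpansion.lean`), gives

  `M^n S^{(w)}_n(M/N) = ∑_{o<w} a^ℚ_o L_{o+1}(M/N) + a^ℚ`,

where `L_s = ∑_{k ≥ 1} x^k/k^s` (`DilogPade.polylogSeries s (M/N)`),
`a^ℚ_o = coefWQ n c N M o = ∑_p c_{o,p} N^p M^{n−p}` and
`a^ℚ = constWQ n w c N M = −∑_{o<w} ∑_{p≤n} c_{o,p} ∑_{1 ≤ m ≤ p} N^p M^{n−p} M^m/(N^m m^{o+1})`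
(`PolylogHermitePadeRational.lean`).

* `pow_mul_formW_eq_of_pfEval` — the identity above (the rational-point analogue of
  `PolylogPade.formW_eq_of_pfEval`, which is the case `M = 1`, and the every-weight analogue of
  `DilogPade.pow_mul_form_eq_rat`).

The computation: with `x = M/N` one has `N^j x^j = M^j`, so for `p ≤ n`
`M^n ∑_{u ≥ 0} x^{u+1}/(u+1+p)^s = N^p M^{n−p} (L_s − ∑_{k<p} x^{k+1}/(k+1)^s)`
(`DilogPade.pow_mul_tsum_shift`), and in the finite remainder
`x^{k+1}/(k+1)^s = M^m/(N^m m^s)` with `m = k + 1 ∈ [1, p]`.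

References: S. David, N. Hirata-Kohno, M. Kawashima, *Can polylogarithms at algebraic points be
linearly independent?*, Moscow J. Comb. Number Th. 9 (2020), Thm 2.1; M. Hata, *On the linear
independence of the values of polylogarithmic functions*, J. Math. Pures Appl. 69 (1990).
Everything here is PROVED from Mathlib's `tsum` API and the sibling files; no definitions, no named
facts.
-/

noncomputable section

open Finset

namespace Literature.NumberTheory.DiophantineApproximation

namespace PolylogPade

open Literature.NumberTheory.Transcendental

/-- Reindexing a sum over `Icc 1 p` by `m = k + 1`, `k < p`. [folklore] -/
private theorem sum_Icc_one_eq_sum_range_succ' {A : Type*} [AddCommMonoid A] (f : ℕ → A)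
    (p : ℕ) : ∑ m ∈ Icc 1 p, f m = ∑ k ∈ range p, f (k + 1) := by
  rw [← Finset.Ico_add_one_right_eq_Icc, Finset.sum_Ico_eq_sum_range, Nat.add_sub_cancel]
  refine Finset.sum_congr rfl fun k _ => ?_
  rw [add_comm]

/-- **The weight-`w` Hermite–Padé form at a rational point `x = M/N`**
(David–Hirata-Kohno–Kawashima 2020, the computation behind Thm 2.1; Hata 1990; Nikišin 1979).
If the kernel has the partial fraction expansion
`R^{(w)}_n(u) = ∑_{p ≤ n} ∑_{o<w} c_{o,p}/(u+p+1)^{o+1}` at the naturals `u`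
(`BallRivoal.pfEval n w c u`), then for natural numbers `1 ≤ M`, `2M ≤ N`
`M^n S^{(w)}_n(M/N) = ∑_{o<w} a^ℚ_o · L_{o+1}(M/N) + a^ℚ`
with `a^ℚ_o = coefWQ n c N M o = ∑_p c_{o,p} N^p M^{n−p}`, `a^ℚ = constWQ n w c N M` and
`L_s = polylogSeries s`. [cite: DavidHirataKohnoKawashima2020, Thm 2.1] -/
theorem pow_mul_formW_eq_of_pfEval {w n N M : ℕ} (hM : 1 ≤ M) (hMN : 2 * M ≤ N)
    (c : ℕ → ℕ → ℚ) (hc : ∀ u : ℕ, kernelW w n u = BallRivoal.pfEval n w c u) :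
    (M : ℝ) ^ n * formW w n ((M : ℝ) / N) =
      (∑ o ∈ Finset.range w,
          ((coefWQ n c N M o : ℚ) : ℝ) * DilogPade.polylogSeries (o + 1) ((M : ℝ) / N)) +
        ((constWQ n w c N M : ℚ) : ℝ) := by
  have hNpos : (0 : ℝ) < N := Nat.cast_pos.mpr (by omega)
  have hN0 : (N : ℝ) ≠ 0 := hNpos.ne'
  set x : ℝ := (M : ℝ) / N with hx
  have hx0 : 0 ≤ x := by positivity
  have hx1 : x < 1 := by
    rw [hx, div_lt_one hNpos]
    exact_mod_cast (by omega : M < N)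
  have hNx : ∀ j : ℕ, (N : ℝ) ^ j * x ^ j = (M : ℝ) ^ j := fun j => by
    rw [← mul_pow, hx, mul_div_cancel₀ _ hN0]
  -- summability of the shifted series, and the shift identity multiplied by
  -- `M^n = M^{n-p} · N^p x^p` (`p ≤ n`)
  have hS : ∀ s i : ℕ, Summable fun t : ℕ => x ^ (t + 1) / ((t : ℝ) + 1 + i) ^ s :=
    fun s i => DilogPade.summable_pow_div_shift s i hx0 hx1
  have hg : ∀ s : ℕ, ∀ p ∈ range (n + 1),
      (M : ℝ) ^ n * ∑' t : ℕ, x ^ (t + 1) / ((t : ℝ) + 1 + p) ^ s =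
        (N : ℝ) ^ p * (M : ℝ) ^ (n - p) *
          (DilogPade.polylogSeries s x - ∑ k ∈ range p, x ^ (k + 1) / ((k : ℝ) + 1) ^ s) := by
    intro s p hp
    have hpn : p ≤ n := by have := mem_range.mp hp; omega
    have hMn : (M : ℝ) ^ n = (M : ℝ) ^ (n - p) * ((N : ℝ) ^ p * x ^ p) := by
      rw [hNx, ← pow_add, Nat.sub_add_cancel hpn]
    rw [hMn, ← DilogPade.pow_mul_tsum_shift s p hx0 hx1]
    ring
  -- Step 1: expand the kernel by `hc` (cast from `ℚ` to `ℝ`) and exchange `tsum` and finite sums.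
  have hterm : ∀ u : ℕ, (kernelW w n u : ℝ) * x ^ (u + 1) =
      ∑ p ∈ range (n + 1), ∑ o ∈ range w,
        (c o p : ℝ) * (x ^ (u + 1) / ((u : ℝ) + 1 + p) ^ (o + 1)) := by
    intro u
    have hcu : (kernelW w n u : ℝ) =
        ∑ p ∈ range (n + 1), ∑ o ∈ range w, (c o p : ℝ) / ((u : ℝ) + 1 + p) ^ (o + 1) := by
      rw [hc u]
      push_cast [BallRivoal.pfEval]
      refine Finset.sum_congr rfl fun p _ => Finset.sum_congr rfl fun o _ => ?_
      rw [add_right_comm (u : ℝ) 1 (p : ℝ)]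
    rw [hcu, Finset.sum_mul]
    refine Finset.sum_congr rfl fun p _ => ?_
    rw [Finset.sum_mul]
    refine Finset.sum_congr rfl fun o _ => ?_
    ring
  have h1 : formW w n x = ∑ p ∈ range (n + 1), ∑ o ∈ range w,
      (c o p : ℝ) * ∑' u : ℕ, x ^ (u + 1) / ((u : ℝ) + 1 + p) ^ (o + 1) := by
    rw [formW, tsum_congr hterm, Summable.tsum_finsetSum fun p _ =>
      summable_sum fun o _ => (hS (o + 1) p).mul_left (c o p : ℝ)]
    refine Finset.sum_congr rfl fun p _ => ?_
    rw [Summable.tsum_finsetSum fun o _ => (hS (o + 1) p).mul_left (c o p : ℝ)]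
    refine Finset.sum_congr rfl fun o _ => ?_
    exact tsum_mul_left
  -- Step 2: the finite remainders at `x = M/N`: `x^{k+1}/(k+1)^{o+1} = M^m/(N^m m^{o+1})`
  -- with `m = k + 1 ∈ Icc 1 p`.
  have hfin : ∀ p o : ℕ, (N : ℝ) ^ p * (M : ℝ) ^ (n - p) *
      ∑ k ∈ range p, x ^ (k + 1) / ((k : ℝ) + 1) ^ (o + 1) =
      ∑ m ∈ Icc 1 p, (N : ℝ) ^ p * (M : ℝ) ^ (n - p) *
        ((M : ℝ) ^ m / ((N : ℝ) ^ m * (m : ℝ) ^ (o + 1))) := by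
    intro p o
    rw [sum_Icc_one_eq_sum_range_succ', Finset.mul_sum]
    refine Finset.sum_congr rfl fun k _ => ?_
    push_cast
    rw [hx, div_pow, div_div]
  have h2 : (M : ℝ) ^ n * formW w n x = ∑ p ∈ range (n + 1), ∑ o ∈ range w,
      ((c o p : ℝ) * (N : ℝ) ^ p * (M : ℝ) ^ (n - p) * DilogPade.polylogSeries (o + 1) x -
        (c o p : ℝ) * ∑ m ∈ Icc 1 p, (N : ℝ) ^ p * (M : ℝ) ^ (n - p) *
          ((M : ℝ) ^ m / ((N : ℝ) ^ m * (m : ℝ) ^ (o + 1)))) := by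
    rw [h1, Finset.mul_sum]
    refine Finset.sum_congr rfl fun p hp => ?_
    rw [Finset.mul_sum]
    refine Finset.sum_congr rfl fun o _ => ?_
    rw [mul_left_comm, hg (o + 1) p hp, ← hfin]
    ring
  -- Step 3: swap the two finite sums and identify the coefficients.
  have hA : ∀ o : ℕ, ((coefWQ n c N M o : ℚ) : ℝ) * DilogPade.polylogSeries (o + 1) x =
      ∑ p ∈ range (n + 1),
        (c o p : ℝ) * (N : ℝ) ^ p * (M : ℝ) ^ (n - p) * DilogPade.polylogSeries (o + 1) x := by
    intro o
    push_cast [coefWQ]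
    rw [Finset.sum_mul]
  have hC : ((constWQ n w c N M : ℚ) : ℝ) = -∑ o ∈ range w, ∑ p ∈ range (n + 1),
      (c o p : ℝ) * ∑ m ∈ Icc 1 p, (N : ℝ) ^ p * (M : ℝ) ^ (n - p) *
        ((M : ℝ) ^ m / ((N : ℝ) ^ m * (m : ℝ) ^ (o + 1))) := by
    push_cast [constWQ]
    rfl
  rw [h2, Finset.sum_comm]
  simp only [Finset.sum_sub_distrib]
  simp_rw [hA]
  rw [hC]
  ring

end PolylogPade

end Literature.NumberTheory.DiophantineApproximation
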